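import Summits.CriticalPhenomena.PercolationContinuityZ3.Theorems.PercNearOneGluingNoHeavyLowerTailFrontierDecRowsEdgeInduction
import Literature.Probability.LatticeModels.ProdBernoulliIndependence
import HarnessLib

/-!
# The increasing star `E₃({s↔b},{s↔c},{s↔y})`: the ROOT-EDGE induction schema

Support file for the Sahi programme (`--supports stmt-CriticalPhenomena-4575`, prover prim-sahi-p2 gen 4).  No definitions, no named facts,
no sorries; standard axioms.  Memo `run/shared/lean/prim/prim-sahi/FROM-prim-sahi-p2-gen4-INC-STAR.md`, `prim-sahi-p2/PROOF-E3.md` §15.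

The three events of the increasing star ("hub connections") are determined by the open cluster of the root `s` alone.  This lets the
edge induction of `EdgeInduction.sahiE3_nonneg_of_edgeBernstein` (prim-l12-p1; hypotheses for EVERY edge) be run through edges AT THE
ROOT only: if some fractional edge is incident to the root, expand `E₃` in its weight (tree: `EdgeInduction.sahiE3_oneBond`); if the root
is joined by weight-`1` edges to a vertex `z`, re-root at `z` (the three events are a.s. unchanged, `sahiE3_hub_eq_of_sureReachable`);
and if every edge leaving the weight-`1` component of the root has weight `0`, the cluster of the root is a.s. deterministic and `E₃ = 0`
(`sahiE3_hub_eq_zero_of_closed`).  Loops `s(v,v)` never matter.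

**Theorem `incStar_nonneg_of_rootEdgeBernstein`.**  Fix `n`.  Suppose that for every weight `w`, all vertices `s b c y` and every
vertex `v ≠ s`, both mixed Bernstein coefficients of `E₃({s↔b},{s↔c},{s↔y})` along the root edge `e = s(s,v)` are nonnegative:
`0 ≤ polar₁ P_{w[e↦0]} P_{w[e↦1]}` and `0 ≤ polar₁ P_{w[e↦1]} P_{w[e↦0]}` (evaluated on the three events).  Then
`0 ≤ E₃({s↔b},{s↔c},{s↔y})` under `prodBernoulli w` for every `w` and all `s b c y`.
The hypothesis consists of two families only: `v` a target (a cubic inequality in the 15-cell four-point law of `(s,b,c,y)` on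
`w[e↦0]`, the lifted events being `{s↔j} ∪ {v↔j}`) and `v` an unmarked vertex (52-cell five-point law of `(s,b,c,y,v)`); both are
census-clean and three-copy fibre-positive (memo §7), and their certification would make the increasing star a theorem for all graphs.
-/

noncomputable section

namespace Summit.CriticalPhenomena.PercolationContinuityZ3.Theorems

namespace IncStar

open MeasureTheory Set Literature.Probability.Percolation Literature.Probability.LatticeModels EdgeInduction
open scoped Classical

variable {n : ℕ}

/-! ### The almost-sure configuration set: weight-1 edges open, weight-0 edges closed -/

/-- Weight-`1` pairs are almost surely open: `P({e | w e = 1} ⊆ ω) = 1`. [folklore] -/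
theorem real_sureOpen (w : Sym2 (Fin n) → unitInterval) :
    (prodBernoulli w).real {ω | ∀ e, w e = 1 → e ∈ ω} = 1 := by
  have h := prodBernoulli_real_subset w (Finset.univ.filter fun e => w e = 1)
  have hset : {ω : Set (Sym2 (Fin n)) | ((Finset.univ.filter fun e => w e = 1 : Finset (Sym2 (Fin n))) : Set (Sym2 (Fin n))) ⊆ ω}
      = {ω | ∀ e, w e = 1 → e ∈ ω} := by
    ext ω; simp [Set.subset_def]
  rw [hset] at h
  rw [h]
  refine Finset.prod_eq_one fun e he => ?_
  simp only [Finset.mem_filter, Finset.mem_univ, true_and] at he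
  simp [he]

/-- Weight-`0` pairs are almost surely closed: `P(∀ e, w e = 0 → e ∉ ω) = 1`. [folklore] -/
theorem real_sureClosed (w : Sym2 (Fin n) → unitInterval) :
    (prodBernoulli w).real {ω | ∀ e, w e = 0 → e ∉ ω} = 1 := by
  have h := prodBernoulli_real_forall_notMem w (Finset.univ.filter fun e => w e = 0)
  have hset : {ω : Set (Sym2 (Fin n)) | ∀ i ∈ (Finset.univ.filter fun e => w e = 0 : Finset (Sym2 (Fin n))), i ∉ ω}
      = {ω | ∀ e, w e = 0 → e ∉ ω} := by
    ext ω; simp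
  rw [hset] at h
  rw [h]
  refine Finset.prod_eq_one fun e he => ?_
  simp only [Finset.mem_filter, Finset.mem_univ, true_and] at he
  simp [he]

/-- If `P(G) = 1` then `P(S) = P(S ∩ G)` (probability measure). [folklore] -/
theorem real_eq_real_inter_of_real_eq_one {μ : Measure (BondConfig (Fin n))} [IsProbabilityMeasure μ]
    {G : Set (BondConfig (Fin n))} (hGm : MeasurableSet G) (hG : μ.real G = 1) (S : Set (BondConfig (Fin n))) :
    μ.real S = μ.real (S ∩ G) := by
  have hGc : μ.real Gᶜ = 0 := by
    rw [measureReal_compl hGm, hG]; simp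
  have h1 : μ.real S ≤ μ.real (S ∩ G) + μ.real (S \ G) := by
    calc μ.real S = μ.real (S ∩ G ∪ S \ G) := by rw [Set.inter_union_sdiff]
      _ ≤ μ.real (S ∩ G) + μ.real (S \ G) := measureReal_union_le _ _
  have h2 : μ.real (S \ G) ≤ μ.real Gᶜ := measureReal_mono (fun ω hω => hω.2)
  have h3 : μ.real (S ∩ G) ≤ μ.real S := measureReal_mono Set.inter_subset_left
  linarith

/-- The a.s. set: all weight-`1` pairs open and all weight-`0` pairs closed. [folklore] -/
theorem real_sureSet (w : Sym2 (Fin n) → unitInterval) :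
    (prodBernoulli w).real ({ω | ∀ e, w e = 1 → e ∈ ω} ∩ {ω | ∀ e, w e = 0 → e ∉ ω}) = 1 := by
  have hm : MeasurableSet {ω : BondConfig (Fin n) | ∀ e, w e = 0 → e ∉ ω} := MeasurableSet.of_discrete
  rw [← real_eq_real_inter_of_real_eq_one hm (real_sureClosed w)]
  exact real_sureOpen w

/-! ### Deterministic facts on the a.s. set -/

/-- The graph of weight-`1` pairs. -/
private theorem sure_le_open {w : Sym2 (Fin n) → unitInterval} {ω : BondConfig (Fin n)} (hω : ∀ e, w e = 1 → e ∈ ω) :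
    SimpleGraph.fromEdgeSet {e : Sym2 (Fin n) | w e = 1} ≤ openGraph ω := by
  intro u v huv
  rw [SimpleGraph.fromEdgeSet_adj] at huv
  rw [openGraph_adj]
  exact ⟨hω _ huv.1, huv.2⟩

/-- On the a.s. set, a vertex `z` joined to `s` by weight-`1` edges has the same open cluster as `s`. [this work] -/
theorem openConn_inter_eq_of_sureReachable (w : Sym2 (Fin n) → unitInterval) {s z : Fin n}
    (hsz : (SimpleGraph.fromEdgeSet {e : Sym2 (Fin n) | w e = 1}).Reachable s z) (i : Fin n) :
    openConn s i ∩ {ω | ∀ e, w e = 1 → e ∈ ω} = openConn z i ∩ {ω | ∀ e, w e = 1 → e ∈ ω} := by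
  ext ω
  simp only [Set.mem_inter_iff, openConn, Set.mem_setOf_eq]
  constructor
  · rintro ⟨h, hω⟩; exact ⟨((hsz.mono (sure_le_open hω)).symm.trans h), hω⟩
  · rintro ⟨h, hω⟩; exact ⟨((hsz.mono (sure_le_open hω)).trans h), hω⟩

/-- **Closed weight-1 component.**  If every non-loop pair `s(z,v)` with `z` in the weight-`1` component `K` of `s` and `v ∉ K` has
weight `0`, then on the a.s. set `{s ↔ i}` holds iff `i ∈ K`. [this work] -/
theorem openConn_iff_sureReachable_of_closed (w : Sym2 (Fin n) → unitInterval) (s : Fin n)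
    (hcl : ∀ z v : Fin n, (SimpleGraph.fromEdgeSet {e : Sym2 (Fin n) | w e = 1}).Reachable s z →
      ¬ (SimpleGraph.fromEdgeSet {e : Sym2 (Fin n) | w e = 1}).Reachable s v → z ≠ v → w s(z, v) = 0)
    {ω : BondConfig (Fin n)} (hω1 : ∀ e, w e = 1 → e ∈ ω) (hω0 : ∀ e, w e = 0 → e ∉ ω) (i : Fin n) :
    ω ∈ openConn s i ↔ (SimpleGraph.fromEdgeSet {e : Sym2 (Fin n) | w e = 1}).Reachable s i := by
  set G1 := SimpleGraph.fromEdgeSet {e : Sym2 (Fin n) | w e = 1} with hG1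
  constructor
  · intro h
    simp only [openConn, Set.mem_setOf_eq] at h
    by_contra hi
    obtain ⟨p⟩ := h
    -- the open walk from s (in K) to i (outside K) crosses the boundary of K
    obtain ⟨d, hd, hdK, hdK'⟩ := p.exists_boundary_dart {v | G1.Reachable s v} (SimpleGraph.Reachable.refl s) hi
    have hadj := d.adj
    rw [openGraph_adj] at hadj
    have hne : d.toProd.1 ≠ d.toProd.2 := hadj.2
    have h0 : w s(d.toProd.1, d.toProd.2) = 0 := hcl _ _ hdK hdK' hne
    exact hω0 _ h0 hadj.1
  · intro h
    simp only [openConn, Set.mem_setOf_eq]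
    exact h.mono (sure_le_open hω1)

/-! ### Consequences for `E₃` of the hub connections -/

/-- Re-rooting along weight-1 edges does not change `E₃` of the hub connections. [this work] -/
theorem sahiE3_hub_eq_of_sureReachable (w : Sym2 (Fin n) → unitInterval) {s z : Fin n}
    (hsz : (SimpleGraph.fromEdgeSet {e : Sym2 (Fin n) | w e = 1}).Reachable s z) (b c y : Fin n) :
    sahiE3 (prodBernoulli w) (openConn s b) (openConn s c) (openConn s y) =
      sahiE3 (prodBernoulli w) (openConn z b) (openConn z c) (openConn z y) := by
  have hG := real_sureOpen w
  have hm : MeasurableSet {ω : BondConfig (Fin n) | ∀ e, w e = 1 → e ∈ ω} := MeasurableSet.of_discrete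
  have key : ∀ S : Set (BondConfig (Fin n)), ∀ i, (prodBernoulli w).real (openConn s i ∩ S) = (prodBernoulli w).real (openConn z i ∩ S) := by
    intro S i
    rw [real_eq_real_inter_of_real_eq_one hm hG, real_eq_real_inter_of_real_eq_one hm hG (openConn z i ∩ S),
      Set.inter_right_comm, openConn_inter_eq_of_sureReachable w hsz i, ← Set.inter_right_comm]
  have k1 : ∀ i, (prodBernoulli w).real (openConn s i) = (prodBernoulli w).real (openConn z i) := by
    intro i; simpa using key Set.univ i
  simp only [sahiE3_def]
  -- rewrite every probability with root s into root z, innermost events first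
  have e3 : (prodBernoulli w).real (openConn s b ∩ openConn s c ∩ openConn s y) =
      (prodBernoulli w).real (openConn z b ∩ openConn z c ∩ openConn z y) := by
    rw [Set.inter_assoc, key, Set.inter_comm, Set.inter_assoc, key, Set.inter_comm, Set.inter_assoc, key]
    congr 1; ext ω; simp only [Set.mem_inter_iff]; tauto
  have e2 : ∀ i j, (prodBernoulli w).real (openConn s i ∩ openConn s j) = (prodBernoulli w).real (openConn z i ∩ openConn z j) := by
    intro i j
    rw [key, Set.inter_comm, key, Set.inter_comm]
  rw [e3, e2 c y, e2 b y, e2 b c, k1 b, k1 c, k1 y]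

/-- If the weight-1 component of the root is closed (every pair leaving it has weight `0`), `E₃` of the hub connections vanishes:
the cluster of the root is a.s. deterministic. [this work] -/
theorem sahiE3_hub_eq_zero_of_closed (w : Sym2 (Fin n) → unitInterval) (s : Fin n)
    (hcl : ∀ z v : Fin n, (SimpleGraph.fromEdgeSet {e : Sym2 (Fin n) | w e = 1}).Reachable s z →
      ¬ (SimpleGraph.fromEdgeSet {e : Sym2 (Fin n) | w e = 1}).Reachable s v → z ≠ v → w s(z, v) = 0)
    (b c y : Fin n) :
    sahiE3 (prodBernoulli w) (openConn s b) (openConn s c) (openConn s y) = 0 := by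
  set G : Set (BondConfig (Fin n)) := {ω | ∀ e, w e = 1 → e ∈ ω} ∩ {ω | ∀ e, w e = 0 → e ∉ ω} with hGdef
  have hG : (prodBernoulli w).real G = 1 := real_sureSet w
  have hm : MeasurableSet G := MeasurableSet.of_discrete
  set R : Fin n → Prop := fun i => (SimpleGraph.fromEdgeSet {e : Sym2 (Fin n) | w e = 1}).Reachable s i with hR
  -- on G every hub connection is the constant event [R i]
  have hconst : ∀ i, openConn s i ∩ G = {ω | R i} ∩ G := by
    intro i; ext ω
    simp only [Set.mem_inter_iff, Set.mem_setOf_eq, hGdef]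
    constructor
    · rintro ⟨h, h1, h0⟩; exact ⟨(openConn_iff_sureReachable_of_closed w s hcl h1 h0 i).1 h, h1, h0⟩
    · rintro ⟨h, h1, h0⟩; exact ⟨(openConn_iff_sureReachable_of_closed w s hcl h1 h0 i).2 h, h1, h0⟩
  have hval : ∀ S : Set (BondConfig (Fin n)), ∀ (P : Prop), S ∩ G = {_ω | P} ∩ G →
      (prodBernoulli w).real S = if P then 1 else 0 := by
    intro S P hS
    rw [real_eq_real_inter_of_real_eq_one hm hG S, hS]
    by_cases hP : P
    · simp only [hP, Set.setOf_true, Set.univ_inter, if_true]; exact hG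
    · simp [hP]
  have v1 : ∀ i, (prodBernoulli w).real (openConn s i) = if R i then 1 else 0 := fun i => by
    convert hval _ _ (hconst i)
  have v2 : ∀ i j, (prodBernoulli w).real (openConn s i ∩ openConn s j) = if (R i ∧ R j) then 1 else 0 := by
    intro i j
    convert hval _ (R i ∧ R j) ?_ using 2
    ext ω; constructor
    · rintro ⟨⟨hi, hj⟩, hω⟩
      exact ⟨⟨((Set.ext_iff.1 (hconst i) ω).1 ⟨hi, hω⟩).1, ((Set.ext_iff.1 (hconst j) ω).1 ⟨hj, hω⟩).1⟩, hω⟩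
    · rintro ⟨⟨hi, hj⟩, hω⟩
      exact ⟨⟨((Set.ext_iff.1 (hconst i) ω).2 ⟨hi, hω⟩).1, ((Set.ext_iff.1 (hconst j) ω).2 ⟨hj, hω⟩).1⟩, hω⟩
  have v3 : (prodBernoulli w).real (openConn s b ∩ openConn s c ∩ openConn s y) = if (R b ∧ R c ∧ R y) then 1 else 0 := by
    convert hval _ (R b ∧ R c ∧ R y) ?_ using 2
    ext ω; constructor
    · rintro ⟨⟨⟨hb, hc⟩, hy⟩, hω⟩
      exact ⟨⟨((Set.ext_iff.1 (hconst b) ω).1 ⟨hb, hω⟩).1, ((Set.ext_iff.1 (hconst c) ω).1 ⟨hc, hω⟩).1,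
        ((Set.ext_iff.1 (hconst y) ω).1 ⟨hy, hω⟩).1⟩, hω⟩
    · rintro ⟨⟨hb, hc, hy⟩, hω⟩
      exact ⟨⟨⟨((Set.ext_iff.1 (hconst b) ω).2 ⟨hb, hω⟩).1, ((Set.ext_iff.1 (hconst c) ω).2 ⟨hc, hω⟩).1⟩,
        ((Set.ext_iff.1 (hconst y) ω).2 ⟨hy, hω⟩).1⟩, hω⟩
  simp only [sahiE3_def, v1, v2, v3]
  by_cases hb : R b <;> by_cases hc : R c <;> by_cases hy : R y <;> (simp [hb, hc, hy]; try norm_num)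

/-! ### The root-edge induction -/

/-- **ROOT-EDGE INDUCTION SCHEMA for the increasing star.**  If both mixed Bernstein coefficients of `E₃({s↔b},{s↔c},{s↔y})`
along every ROOT edge `s(s,v)`, `v ≠ s`, are nonnegative (for every weight and all `s b c y v`), then the increasing star holds on every
weighted graph on `Fin n`. [this work] -/
theorem incStar_nonneg_of_rootEdgeBernstein
    (h : ∀ (w : Sym2 (Fin n) → unitInterval) (s b c y v : Fin n), v ≠ s →
      0 ≤ polar₁ (prodBernoulli (Function.update w s(s, v) 0)) (prodBernoulli (Function.update w s(s, v) 1))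
            (openConn s b) (openConn s c) (openConn s y) ∧
        0 ≤ polar₁ (prodBernoulli (Function.update w s(s, v) 1)) (prodBernoulli (Function.update w s(s, v) 0))
            (openConn s b) (openConn s c) (openConn s y)) :
    ∀ (w : Sym2 (Fin n) → unitInterval) (s b c y : Fin n),
      0 ≤ sahiE3 (prodBernoulli w) (openConn s b) (openConn s c) (openConn s y) := by
  -- induction on the number of fractional NON-LOOP pairs
  suffices H : ∀ (k : ℕ) (w : Sym2 (Fin n) → unitInterval), ((fracEdges w).filter fun e => ¬ e.IsDiag).card ≤ k →
      ∀ s b c y : Fin n, 0 ≤ sahiE3 (prodBernoulli w) (openConn s b) (openConn s c) (openConn s y) from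
    fun w s b c y => H _ w le_rfl s b c y
  intro k
  induction k with
  | zero =>
      intro w hk s b c y
      -- no fractional non-loop pair at all: the weight-1 component of s is closed
      have hnone : ∀ z v : Fin n, z ≠ v → w s(z, v) = 0 ∨ w s(z, v) = 1 := by
        intro z v hzv
        apply eq_zero_or_one_of_not_mem_fracEdges
        intro hmem
        have : s(z, v) ∈ (fracEdges w).filter fun e => ¬ e.IsDiag := by
          rw [Finset.mem_filter]; exact ⟨hmem, by rwa [Sym2.mk_isDiag_iff]⟩
        have := Finset.card_pos.2 ⟨_, this⟩
        omega
      refine le_of_eq (sahiE3_hub_eq_zero_of_closed w s ?_ b c y).symm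
      intro z v hz hv hzv
      rcases hnone z v hzv with h0 | h1
      · exact h0
      · exact absurd (hz.trans (SimpleGraph.Adj.reachable (by
          rw [SimpleGraph.fromEdgeSet_adj]; exact ⟨h1, hzv⟩))) hv
  | succ k ih =>
      intro w hk s b c y
      set G1 := SimpleGraph.fromEdgeSet {e : Sym2 (Fin n) | w e = 1} with hG1
      by_cases hfr : ∃ z v : Fin n, G1.Reachable s z ∧ z ≠ v ∧ s(z, v) ∈ fracEdges w
      · obtain ⟨z, v, hsz, hzv, he⟩ := hfr
        -- re-root at z, then expand along the fractional root edge s(z,v)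
        rw [sahiE3_hub_eq_of_sureReachable w hsz b c y]
        set e : Sym2 (Fin n) := s(z, v) with hedef
        have hnd : ¬ e.IsDiag := by rw [hedef, Sym2.mk_isDiag_iff]; exact hzv
        have hmemf : e ∈ (fracEdges w).filter fun f => ¬ f.IsDiag := Finset.mem_filter.2 ⟨he, hnd⟩
        have hcard : ∀ (u : unitInterval), u = 0 ∨ u = 1 →
            ((fracEdges (Function.update w e u)).filter fun f => ¬ f.IsDiag).card ≤ k := by
          intro u hu
          have hsub : ((fracEdges (Function.update w e u)).filter fun f => ¬ f.IsDiag) ⊆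
              ((fracEdges w).filter fun f => ¬ f.IsDiag).erase e := by
            intro f hf
            rw [Finset.mem_filter] at hf
            have hf' := fracEdges_update_subset w e u hu hf.1
            rw [Finset.mem_erase] at hf' ⊢
            exact ⟨hf'.1, Finset.mem_filter.2 ⟨hf'.2, hf.2⟩⟩
          have h1 := Finset.card_le_card hsub
          rw [Finset.card_erase_of_mem hmemf] at h1
          omega
        have i0 := ih _ (hcard 0 (Or.inl rfl)) z b c y
        have i1 := ih _ (hcard 1 (Or.inr rfl)) z b c y
        obtain ⟨b1, b2⟩ := h w z b c y v hzv.symm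
        have hp0 : (0 : ℝ) ≤ w e := (w e).2.1
        have hp1 : (w e : ℝ) ≤ 1 := (w e).2.2
        rw [sahiE3_oneBond w e]
        have hq : (0 : ℝ) ≤ 1 - w e := sub_nonneg.2 hp1
        positivity
      · -- no fractional pair touches the weight-1 component of s: it is closed
        push Not at hfr
        refine le_of_eq (sahiE3_hub_eq_zero_of_closed w s ?_ b c y).symm
        intro z v hz hv hzv
        rcases eq_zero_or_one_of_not_mem_fracEdges (hfr z v hz hzv) with h0 | h1
        · exact h0
        · exact absurd (hz.trans (SimpleGraph.Adj.reachable (by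
            rw [SimpleGraph.fromEdgeSet_adj]; exact ⟨h1, hzv⟩))) hv

/-- **ROOT-EDGE INDUCTION SCHEMA, induction-hypothesis form.**  As `incStar_nonneg_of_rootEdgeBernstein`, but the Bernstein hypothesis along the root
edge `e = s(s,v)` may use the increasing star under BOTH endpoint laws `P_{w[e↦0]}`, `P_{w[e↦1]}` (these are exactly the induction hypotheses available at the
step; the root–target certificates of `…IncStarRootTargetStep` need the first one). [this work] -/
theorem incStar_nonneg_of_rootEdgeBernsteinIH
    (h : ∀ (w : Sym2 (Fin n) → unitInterval) (s b c y v : Fin n), v ≠ s →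
      0 ≤ sahiE3 (prodBernoulli (Function.update w s(s, v) 0)) (openConn s b) (openConn s c) (openConn s y) →
      0 ≤ sahiE3 (prodBernoulli (Function.update w s(s, v) 1)) (openConn s b) (openConn s c) (openConn s y) →
      0 ≤ polar₁ (prodBernoulli (Function.update w s(s, v) 0)) (prodBernoulli (Function.update w s(s, v) 1))
            (openConn s b) (openConn s c) (openConn s y) ∧
        0 ≤ polar₁ (prodBernoulli (Function.update w s(s, v) 1)) (prodBernoulli (Function.update w s(s, v) 0))
            (openConn s b) (openConn s c) (openConn s y)) :
    ∀ (w : Sym2 (Fin n) → unitInterval) (s b c y : Fin n),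
      0 ≤ sahiE3 (prodBernoulli w) (openConn s b) (openConn s c) (openConn s y) := by
  suffices H : ∀ (k : ℕ) (w : Sym2 (Fin n) → unitInterval), ((fracEdges w).filter fun e => ¬ e.IsDiag).card ≤ k →
      ∀ s b c y : Fin n, 0 ≤ sahiE3 (prodBernoulli w) (openConn s b) (openConn s c) (openConn s y) from
    fun w s b c y => H _ w le_rfl s b c y
  intro k
  induction k with
  | zero =>
      intro w hk s b c y
      have hnone : ∀ z v : Fin n, z ≠ v → w s(z, v) = 0 ∨ w s(z, v) = 1 := by
        intro z v hzv
        apply eq_zero_or_one_of_not_mem_fracEdges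
        intro hmem
        have : s(z, v) ∈ (fracEdges w).filter fun e => ¬ e.IsDiag := by
          rw [Finset.mem_filter]; exact ⟨hmem, by rwa [Sym2.mk_isDiag_iff]⟩
        have := Finset.card_pos.2 ⟨_, this⟩
        omega
      refine le_of_eq (sahiE3_hub_eq_zero_of_closed w s ?_ b c y).symm
      intro z v hz hv hzv
      rcases hnone z v hzv with h0 | h1
      · exact h0
      · exact absurd (hz.trans (SimpleGraph.Adj.reachable (by
          rw [SimpleGraph.fromEdgeSet_adj]; exact ⟨h1, hzv⟩))) hv
  | succ k ih =>
      intro w hk s b c y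
      set G1 := SimpleGraph.fromEdgeSet {e : Sym2 (Fin n) | w e = 1} with hG1
      by_cases hfr : ∃ z v : Fin n, G1.Reachable s z ∧ z ≠ v ∧ s(z, v) ∈ fracEdges w
      · obtain ⟨z, v, hsz, hzv, he⟩ := hfr
        rw [sahiE3_hub_eq_of_sureReachable w hsz b c y]
        set e : Sym2 (Fin n) := s(z, v) with hedef
        have hnd : ¬ e.IsDiag := by rw [hedef, Sym2.mk_isDiag_iff]; exact hzv
        have hmemf : e ∈ (fracEdges w).filter fun f => ¬ f.IsDiag := Finset.mem_filter.2 ⟨he, hnd⟩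
        have hcard : ∀ (u : unitInterval), u = 0 ∨ u = 1 →
            ((fracEdges (Function.update w e u)).filter fun f => ¬ f.IsDiag).card ≤ k := by
          intro u hu
          have hsub : ((fracEdges (Function.update w e u)).filter fun f => ¬ f.IsDiag) ⊆
              ((fracEdges w).filter fun f => ¬ f.IsDiag).erase e := by
            intro f hf
            rw [Finset.mem_filter] at hf
            have hf' := fracEdges_update_subset w e u hu hf.1
            rw [Finset.mem_erase] at hf' ⊢
            exact ⟨hf'.1, Finset.mem_filter.2 ⟨hf'.2, hf.2⟩⟩
          have h1 := Finset.card_le_card hsub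
          rw [Finset.card_erase_of_mem hmemf] at h1
          omega
        have i0 := ih _ (hcard 0 (Or.inl rfl)) z b c y
        have i1 := ih _ (hcard 1 (Or.inr rfl)) z b c y
        obtain ⟨b1, b2⟩ := h w z b c y v hzv.symm i0 i1
        have hp0 : (0 : ℝ) ≤ w e := (w e).2.1
        have hp1 : (w e : ℝ) ≤ 1 := (w e).2.2
        rw [sahiE3_oneBond w e]
        have hq : (0 : ℝ) ≤ 1 - w e := sub_nonneg.2 hp1
        positivity
      · push Not at hfr
        refine le_of_eq (sahiE3_hub_eq_zero_of_closed w s ?_ b c y).symm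
        intro z v hz hv hzv
        rcases eq_zero_or_one_of_not_mem_fracEdges (hfr z v hz hzv) with h0 | h1
        · exact h0
        · exact absurd (hz.trans (SimpleGraph.Adj.reachable (by
            rw [SimpleGraph.fromEdgeSet_adj]; exact ⟨h1, hzv⟩))) hv

end IncStar

end Summit.CriticalPhenomena.PercolationContinuityZ3.Theorems
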